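import Summits.HodgeConjecture.HodgeConjecture.Theorems.R90S3LocalRingIsoNorm      -- ★ G1-a (this seat, p863354): `prod_norm_map_ringEquiv_of_continuous` — (T-abs), the `D_{G∕H,v}` input (brings ★ `FinExplicitTransferFactor`)
import HarnessLib

/-!
# R90-TF · S3 wave 4 (J-S3-3), BRICK G1-b PART 1: the factors `τ_v` and `D_{G∕H,v}` of Rogawski's `Δ‴_v = τ_v · D_{G∕H,v} · κ_v` TRANSPORT ALONG A GROUND-FIELD CHANGE
# (`Theorems/R90S3TransportTauWeyl.lean` — §1–§3 of the G1 payment; PART 2 `Theorems/R90S3TransportDelta.lean` carries `κ_v` and the HEAD = socket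
# `stub_R90_S3_transport_delta` of `Cruxes/H413/Lines/R90_S3_LocalTransportWaveG.lean` :91; split at the 400-line lint)

Cell `hodgecm-mathlib`, crux H413 (`stmt-HodgeConjecture-24833`), route of record `HCCMUnconditional`; programme R90-TF, section S3 (base `R90-C12`), wave 4 «LOCAL TRANSPORT»
(S3-R12; dealer R90-C12-plan (g2): «G1 → K2E4-p14 g12, census-first» 23:19:08Z, RULING S3-R18 23:36:50Z «NO re-cut of G1; (T-abs) is a LEMMA = G1-a, then G1-b = the value
half (τ via hΦμ, κ via ★ p863112, D via G1-a) ⇒ G1 closes OUTRIGHT»).  Seat K2E4-p14 (g12).  Lane `--supports stmt-HodgeConjecture-24833 --as helper`; THEOREMS ONLY; ★-only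
imports (a `Theorems/` file never imports `Cruxes/…/Lines`); ns `…R90.S3`.  Lines-side pay line (typist's pen, G ED. n): `stub_R90_S3_transport_delta … := finExplicitDelta_transport …`
(same binders in the same order).

THE MATHEMATICS [Rogawski1990 §4.9 p. 55; §4.3 p. 43; §14.6 p. 242; §3.5 Prop. 3.5.2 (c) p. 29].  ★ `finExplicitDelta L v H′ γ_H μ γ` is `τ_v(γ_H) · D_{G∕H,v}(γ_H) · κ_v(γ_H, γ)` on
the matching pairs and `0` off them (★ p863138 settles the support half and the matching condition).  Along the S3 currency — `Φ : R_v ≃+* R′_{v′}` bicontinuous (`hc`, `hc′`),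
intertwining the conjugations (`hΦσ`), carrying the form (`hΦH : Φ(H′ ⊗ 1) = H″ ⊗ 1`) and the character (`hΦμ : μ′_{v′} ∘ Φ = μ_v` on units), with `e₃, e₂, e₁, e_H = (e₂, e₁)` acting
ENTRYWISE by `Φ` (`heₙ`, `heH`) — every ingredient is carried by `Φ`:
* §1 (entries) `ι`-free coordinates: `(e_H γ_H).1 = Φ·g`, `(e_H γ_H).2 = Φ·γ₂`, `e₃ γ = Φ·γ` as matrices;
* §2 (τ) `γ₂ ↦ Φ γ₂`, `χ_g ↦ χ_g^Φ` (Mathlib `Matrix.charpoly_map`), `χ_g(γ₂) ↦ Φ(χ_g(γ₂))`, `det g⁻¹ ↦ Φ(det g⁻¹)`, and `μ′_{v′}(Φ x) = μ_v(x)` (`hΦμ`; units ↔ units) ⇒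
  `τ_{v′}(e_H γ_H) = τ_v(γ_H)` (`finTau_transport`);
* §3 (D) `D_{G∕H,v′}(e_H γ_H) = √(∏_{w′} ‖Φ(χ_g(γ₂))_{w′}‖) = √(∏_w ‖χ_g(γ₂)_w‖) = D_{G∕H,v}(γ_H)` by G1-a ★ `prod_norm_map_ringEquiv_of_continuous` (`finWeylRatio_transport`);
* (PART 2) §4 (κ) `P_{v′} = Φ·P_v` entrywise (`finEigenlineProjector_transport`), so `P_{v′} = 0 ⟺ P_v = 0`, the first non-zero column index is the same (`Fin.find_congr'`), the local form
  is `Φ`-carried (`hΦH` + ★ `adelicForm_map_adeleToLocal`), hence `x_{v′} = Φ(x_v)` (`finRelPos_transport`); non-splitness transports (★ p863112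
  `subsingleton_placesOver_transport_iff`) and so does the unit-norm test `x = z·z̄` (`hΦσ`, units ↔ units) ⇒ `κ_{v′}(e_H γ_H, e₃ γ) = κ_v(γ_H, γ)` (`finKappaAt_transport`);
* (PART 2) §5 HEAD `finExplicitDelta_transport` = socket G1's conclusion over socket G1's binders VERBATIM.
HONEST LABEL: transport-of-structure bookkeeping, no print input; HC_CM is proved only modulo the 7 printed citations (2 remaining named inputs: hLiu418 = stmt-HodgeConjecture-24832,
h413 = stmt-HodgeConjecture-24833) until rung 0 closes; count-neutral helper — G1 is PAID only when G ED. n plugs `stub_R90_S3_transport_delta := finExplicitDelta_transport …` and is BUILT.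

## References
* [Rogawski1990] J. D. Rogawski, *Automorphic Representations of Unitary Groups in Three Variables*, Ann. of Math. Stud. 123 (1990), §4.9 p. 55; §4.3 p. 43; §14.6 p. 242; §3.5
  Prop. 3.5.2 (c) p. 29.
-/

set_option autoImplicit false
-- the mandated namespace repeats the single-problem summit's segment (`HodgeConjecture.HodgeConjecture`)
set_option linter.dupNamespace false

noncomputable section

open IsDedekindDomain NumberField
open Literature.NumberTheory Literature.NumberTheory.Automorphic Literature.NumberTheory.Automorphic.UnitaryGroup
open Literature.NumberTheory.Rogawski1990 Literature.NumberTheory.GaloisRepresentations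
open scoped Matrix MatrixGroups

namespace Summit.HodgeConjecture.HodgeConjecture.R90.S3

variable (L : Type) [Field L] [NumberField L] [IsCMField L] (H' : Matrix (Fin 3) (Fin 3) L)
  (v : HeightOneSpectrum (𝓞 ↥(maximalRealSubfield L)))

/-! ## §1 The coordinates of `e_H γ_H` and `e₃ γ` are `Φ` applied entrywise -/

/-- `(e_H γ_H).1 = Φ · γ_H.1` as matrices (`heH`, `he₂`). [cite: Rogawski1990, §4.9 p. 55] -/
theorem coe_fst_transport
    (L' : Type) [Field L'] [NumberField L'] [IsCMField L'] (v' : HeightOneSpectrum (𝓞 ↥(maximalRealSubfield L')))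
    (Φ : UnitaryGroup.LocalRing L v ≃+* UnitaryGroup.LocalRing L' v')
    (e₂ : (UnitaryGroup.cmDatum L 2 (Matrix.of fun i j : Fin 2 => if i.val + j.val + 1 = 2 then (1 : L) else 0)).Local v ≃ₜ*
      (UnitaryGroup.cmDatum L' 2 (Matrix.of fun i j : Fin 2 => if i.val + j.val + 1 = 2 then (1 : L') else 0)).Local v')
    (he₂ : ∀ g, ((e₂ g).val : GL (Fin 2) (UnitaryGroup.LocalRing L' v')) = Matrix.GeneralLinearGroup.map (Φ : UnitaryGroup.LocalRing L v →+* UnitaryGroup.LocalRing L' v') (g.val : GL (Fin 2) (UnitaryGroup.LocalRing L v)))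
    (e₁ : (UnitaryGroup.cmDatum L 1 (Matrix.of fun i j : Fin 1 => if i.val + j.val + 1 = 1 then (1 : L) else 0)).Local v ≃ₜ*
      (UnitaryGroup.cmDatum L' 1 (Matrix.of fun i j : Fin 1 => if i.val + j.val + 1 = 1 then (1 : L') else 0)).Local v')
    (eH : ((UnitaryGroup.cmDatum L 2 (Matrix.of fun i j : Fin 2 => if i.val + j.val + 1 = 2 then (1 : L) else 0)).Local v ×
      (UnitaryGroup.cmDatum L 1 (Matrix.of fun i j : Fin 1 => if i.val + j.val + 1 = 1 then (1 : L) else 0)).Local v) ≃ₜ*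
      ((UnitaryGroup.cmDatum L' 2 (Matrix.of fun i j : Fin 2 => if i.val + j.val + 1 = 2 then (1 : L') else 0)).Local v' ×
      (UnitaryGroup.cmDatum L' 1 (Matrix.of fun i j : Fin 1 => if i.val + j.val + 1 = 1 then (1 : L') else 0)).Local v'))
    (heH : ∀ h, eH h = (e₂ h.1, e₁ h.2))
    (γH : ((UnitaryGroup.cmDatum L 2 (Matrix.of fun i j : Fin 2 => if i.val + j.val + 1 = 2 then (1 : L) else 0)).Local v ×
      (UnitaryGroup.cmDatum L 1 (Matrix.of fun i j : Fin 1 => if i.val + j.val + 1 = 1 then (1 : L) else 0)).Local v)) :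
    ((eH γH).1.val.val : Matrix (Fin 2) (Fin 2) (UnitaryGroup.LocalRing L' v')) =
      (γH.1.val.val : Matrix (Fin 2) (Fin 2) (UnitaryGroup.LocalRing L v)).map Φ := by
  rw [heH]
  dsimp only
  rw [he₂]
  rfl

/-- `(e_H γ_H).2 = Φ · γ_H.2` as matrices (`heH`, `he₁`). [cite: Rogawski1990, §4.9 p. 55] -/
theorem coe_snd_transport
    (L' : Type) [Field L'] [NumberField L'] [IsCMField L'] (v' : HeightOneSpectrum (𝓞 ↥(maximalRealSubfield L')))
    (Φ : UnitaryGroup.LocalRing L v ≃+* UnitaryGroup.LocalRing L' v')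
    (e₂ : (UnitaryGroup.cmDatum L 2 (Matrix.of fun i j : Fin 2 => if i.val + j.val + 1 = 2 then (1 : L) else 0)).Local v ≃ₜ*
      (UnitaryGroup.cmDatum L' 2 (Matrix.of fun i j : Fin 2 => if i.val + j.val + 1 = 2 then (1 : L') else 0)).Local v')
    (e₁ : (UnitaryGroup.cmDatum L 1 (Matrix.of fun i j : Fin 1 => if i.val + j.val + 1 = 1 then (1 : L) else 0)).Local v ≃ₜ*
      (UnitaryGroup.cmDatum L' 1 (Matrix.of fun i j : Fin 1 => if i.val + j.val + 1 = 1 then (1 : L') else 0)).Local v')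
    (he₁ : ∀ g, ((e₁ g).val : GL (Fin 1) (UnitaryGroup.LocalRing L' v')) = Matrix.GeneralLinearGroup.map (Φ : UnitaryGroup.LocalRing L v →+* UnitaryGroup.LocalRing L' v') (g.val : GL (Fin 1) (UnitaryGroup.LocalRing L v)))
    (eH : ((UnitaryGroup.cmDatum L 2 (Matrix.of fun i j : Fin 2 => if i.val + j.val + 1 = 2 then (1 : L) else 0)).Local v ×
      (UnitaryGroup.cmDatum L 1 (Matrix.of fun i j : Fin 1 => if i.val + j.val + 1 = 1 then (1 : L) else 0)).Local v) ≃ₜ*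
      ((UnitaryGroup.cmDatum L' 2 (Matrix.of fun i j : Fin 2 => if i.val + j.val + 1 = 2 then (1 : L') else 0)).Local v' ×
      (UnitaryGroup.cmDatum L' 1 (Matrix.of fun i j : Fin 1 => if i.val + j.val + 1 = 1 then (1 : L') else 0)).Local v'))
    (heH : ∀ h, eH h = (e₂ h.1, e₁ h.2))
    (γH : ((UnitaryGroup.cmDatum L 2 (Matrix.of fun i j : Fin 2 => if i.val + j.val + 1 = 2 then (1 : L) else 0)).Local v ×
      (UnitaryGroup.cmDatum L 1 (Matrix.of fun i j : Fin 1 => if i.val + j.val + 1 = 1 then (1 : L) else 0)).Local v)) :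
    ((eH γH).2.val.val : Matrix (Fin 1) (Fin 1) (UnitaryGroup.LocalRing L' v')) =
      (γH.2.val.val : Matrix (Fin 1) (Fin 1) (UnitaryGroup.LocalRing L v)).map Φ := by
  rw [heH]
  dsimp only
  rw [he₁]
  rfl

/-- `e₃ γ = Φ · γ` as matrices (`he₃`). [cite: Rogawski1990, §4.9 p. 55] -/
theorem coe_transport₃
    (L' : Type) [Field L'] [NumberField L'] [IsCMField L'] (v' : HeightOneSpectrum (𝓞 ↥(maximalRealSubfield L')))
    (Φ : UnitaryGroup.LocalRing L v ≃+* UnitaryGroup.LocalRing L' v') (H'' : Matrix (Fin 3) (Fin 3) L')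
    (e₃ : (UnitaryGroup.cmDatum L 3 H').Local v ≃ₜ* (UnitaryGroup.cmDatum L' 3 H'').Local v')
    (he₃ : ∀ g, ((e₃ g).val : GL (Fin 3) (UnitaryGroup.LocalRing L' v')) = Matrix.GeneralLinearGroup.map (Φ : UnitaryGroup.LocalRing L v →+* UnitaryGroup.LocalRing L' v') (g.val : GL (Fin 3) (UnitaryGroup.LocalRing L v)))
    (γ : (UnitaryGroup.cmDatum L 3 H').Local v) :
    ((e₃ γ).val.val : Matrix (Fin 3) (Fin 3) (UnitaryGroup.LocalRing L' v')) =
      (γ.val.val : Matrix (Fin 3) (Fin 3) (UnitaryGroup.LocalRing L v)).map Φ := by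
  rw [he₃]
  rfl

/-! ## §2 (τ): `τ_{v′}(e_H γ_H) = τ_v(γ_H)` -/

/-- `γ₂(e_H γ_H) = Φ(γ₂(γ_H))`. [cite: Rogawski1990, §4.9 p. 55] -/
theorem finGammaTwo_transport
    (L' : Type) [Field L'] [NumberField L'] [IsCMField L'] (v' : HeightOneSpectrum (𝓞 ↥(maximalRealSubfield L')))
    (Φ : UnitaryGroup.LocalRing L v ≃+* UnitaryGroup.LocalRing L' v')
    (e₂ : (UnitaryGroup.cmDatum L 2 (Matrix.of fun i j : Fin 2 => if i.val + j.val + 1 = 2 then (1 : L) else 0)).Local v ≃ₜ*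
      (UnitaryGroup.cmDatum L' 2 (Matrix.of fun i j : Fin 2 => if i.val + j.val + 1 = 2 then (1 : L') else 0)).Local v')
    (e₁ : (UnitaryGroup.cmDatum L 1 (Matrix.of fun i j : Fin 1 => if i.val + j.val + 1 = 1 then (1 : L) else 0)).Local v ≃ₜ*
      (UnitaryGroup.cmDatum L' 1 (Matrix.of fun i j : Fin 1 => if i.val + j.val + 1 = 1 then (1 : L') else 0)).Local v')
    (he₁ : ∀ g, ((e₁ g).val : GL (Fin 1) (UnitaryGroup.LocalRing L' v')) = Matrix.GeneralLinearGroup.map (Φ : UnitaryGroup.LocalRing L v →+* UnitaryGroup.LocalRing L' v') (g.val : GL (Fin 1) (UnitaryGroup.LocalRing L v)))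
    (eH : ((UnitaryGroup.cmDatum L 2 (Matrix.of fun i j : Fin 2 => if i.val + j.val + 1 = 2 then (1 : L) else 0)).Local v ×
      (UnitaryGroup.cmDatum L 1 (Matrix.of fun i j : Fin 1 => if i.val + j.val + 1 = 1 then (1 : L) else 0)).Local v) ≃ₜ*
      ((UnitaryGroup.cmDatum L' 2 (Matrix.of fun i j : Fin 2 => if i.val + j.val + 1 = 2 then (1 : L') else 0)).Local v' ×
      (UnitaryGroup.cmDatum L' 1 (Matrix.of fun i j : Fin 1 => if i.val + j.val + 1 = 1 then (1 : L') else 0)).Local v'))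
    (heH : ∀ h, eH h = (e₂ h.1, e₁ h.2))
    (γH : ((UnitaryGroup.cmDatum L 2 (Matrix.of fun i j : Fin 2 => if i.val + j.val + 1 = 2 then (1 : L) else 0)).Local v ×
      (UnitaryGroup.cmDatum L 1 (Matrix.of fun i j : Fin 1 => if i.val + j.val + 1 = 1 then (1 : L) else 0)).Local v)) :
    finGammaTwo L' v' (eH γH) = Φ (finGammaTwo L v γH) := by
  unfold finGammaTwo
  rw [coe_snd_transport L v L' v' Φ e₂ e₁ he₁ eH heH γH]
  rfl

/-- `χ_{e₂ g} = χ_g^Φ` (Mathlib `Matrix.charpoly_map`). [cite: Rogawski1990, §4.9 p. 55] -/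
theorem finCharpolyTwo_transport
    (L' : Type) [Field L'] [NumberField L'] [IsCMField L'] (v' : HeightOneSpectrum (𝓞 ↥(maximalRealSubfield L')))
    (Φ : UnitaryGroup.LocalRing L v ≃+* UnitaryGroup.LocalRing L' v')
    (e₂ : (UnitaryGroup.cmDatum L 2 (Matrix.of fun i j : Fin 2 => if i.val + j.val + 1 = 2 then (1 : L) else 0)).Local v ≃ₜ*
      (UnitaryGroup.cmDatum L' 2 (Matrix.of fun i j : Fin 2 => if i.val + j.val + 1 = 2 then (1 : L') else 0)).Local v')
    (he₂ : ∀ g, ((e₂ g).val : GL (Fin 2) (UnitaryGroup.LocalRing L' v')) = Matrix.GeneralLinearGroup.map (Φ : UnitaryGroup.LocalRing L v →+* UnitaryGroup.LocalRing L' v') (g.val : GL (Fin 2) (UnitaryGroup.LocalRing L v)))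
    (e₁ : (UnitaryGroup.cmDatum L 1 (Matrix.of fun i j : Fin 1 => if i.val + j.val + 1 = 1 then (1 : L) else 0)).Local v ≃ₜ*
      (UnitaryGroup.cmDatum L' 1 (Matrix.of fun i j : Fin 1 => if i.val + j.val + 1 = 1 then (1 : L') else 0)).Local v')
    (eH : ((UnitaryGroup.cmDatum L 2 (Matrix.of fun i j : Fin 2 => if i.val + j.val + 1 = 2 then (1 : L) else 0)).Local v ×
      (UnitaryGroup.cmDatum L 1 (Matrix.of fun i j : Fin 1 => if i.val + j.val + 1 = 1 then (1 : L) else 0)).Local v) ≃ₜ*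
      ((UnitaryGroup.cmDatum L' 2 (Matrix.of fun i j : Fin 2 => if i.val + j.val + 1 = 2 then (1 : L') else 0)).Local v' ×
      (UnitaryGroup.cmDatum L' 1 (Matrix.of fun i j : Fin 1 => if i.val + j.val + 1 = 1 then (1 : L') else 0)).Local v'))
    (heH : ∀ h, eH h = (e₂ h.1, e₁ h.2))
    (γH : ((UnitaryGroup.cmDatum L 2 (Matrix.of fun i j : Fin 2 => if i.val + j.val + 1 = 2 then (1 : L) else 0)).Local v ×
      (UnitaryGroup.cmDatum L 1 (Matrix.of fun i j : Fin 1 => if i.val + j.val + 1 = 1 then (1 : L) else 0)).Local v)) :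
    finCharpolyTwo L' v' (eH γH) = (finCharpolyTwo L v γH).map (Φ : UnitaryGroup.LocalRing L v →+* UnitaryGroup.LocalRing L' v') := by
  unfold finCharpolyTwo
  rw [coe_fst_transport L v L' v' Φ e₂ he₂ e₁ eH heH γH, ← Matrix.charpoly_map]
  rfl

/-- `χ_{e₂ g}(γ₂(e_H γ_H)) = Φ(χ_g(γ₂))` (`Polynomial.eval₂_at_apply`). [cite: Rogawski1990, §4.9 p. 55] -/
theorem eval_finCharpolyTwo_transport
    (L' : Type) [Field L'] [NumberField L'] [IsCMField L'] (v' : HeightOneSpectrum (𝓞 ↥(maximalRealSubfield L')))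
    (Φ : UnitaryGroup.LocalRing L v ≃+* UnitaryGroup.LocalRing L' v')
    (e₂ : (UnitaryGroup.cmDatum L 2 (Matrix.of fun i j : Fin 2 => if i.val + j.val + 1 = 2 then (1 : L) else 0)).Local v ≃ₜ*
      (UnitaryGroup.cmDatum L' 2 (Matrix.of fun i j : Fin 2 => if i.val + j.val + 1 = 2 then (1 : L') else 0)).Local v')
    (he₂ : ∀ g, ((e₂ g).val : GL (Fin 2) (UnitaryGroup.LocalRing L' v')) = Matrix.GeneralLinearGroup.map (Φ : UnitaryGroup.LocalRing L v →+* UnitaryGroup.LocalRing L' v') (g.val : GL (Fin 2) (UnitaryGroup.LocalRing L v)))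
    (e₁ : (UnitaryGroup.cmDatum L 1 (Matrix.of fun i j : Fin 1 => if i.val + j.val + 1 = 1 then (1 : L) else 0)).Local v ≃ₜ*
      (UnitaryGroup.cmDatum L' 1 (Matrix.of fun i j : Fin 1 => if i.val + j.val + 1 = 1 then (1 : L') else 0)).Local v')
    (he₁ : ∀ g, ((e₁ g).val : GL (Fin 1) (UnitaryGroup.LocalRing L' v')) = Matrix.GeneralLinearGroup.map (Φ : UnitaryGroup.LocalRing L v →+* UnitaryGroup.LocalRing L' v') (g.val : GL (Fin 1) (UnitaryGroup.LocalRing L v)))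
    (eH : ((UnitaryGroup.cmDatum L 2 (Matrix.of fun i j : Fin 2 => if i.val + j.val + 1 = 2 then (1 : L) else 0)).Local v ×
      (UnitaryGroup.cmDatum L 1 (Matrix.of fun i j : Fin 1 => if i.val + j.val + 1 = 1 then (1 : L) else 0)).Local v) ≃ₜ*
      ((UnitaryGroup.cmDatum L' 2 (Matrix.of fun i j : Fin 2 => if i.val + j.val + 1 = 2 then (1 : L') else 0)).Local v' ×
      (UnitaryGroup.cmDatum L' 1 (Matrix.of fun i j : Fin 1 => if i.val + j.val + 1 = 1 then (1 : L') else 0)).Local v'))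
    (heH : ∀ h, eH h = (e₂ h.1, e₁ h.2))
    (γH : ((UnitaryGroup.cmDatum L 2 (Matrix.of fun i j : Fin 2 => if i.val + j.val + 1 = 2 then (1 : L) else 0)).Local v ×
      (UnitaryGroup.cmDatum L 1 (Matrix.of fun i j : Fin 1 => if i.val + j.val + 1 = 1 then (1 : L) else 0)).Local v)) :
    (finCharpolyTwo L' v' (eH γH)).eval (finGammaTwo L' v' (eH γH)) = Φ ((finCharpolyTwo L v γH).eval (finGammaTwo L v γH)) := by
  rw [finCharpolyTwo_transport L v L' v' Φ e₂ he₂ e₁ eH heH γH, finGammaTwo_transport L v L' v' Φ e₂ e₁ he₁ eH heH γH, Polynomial.eval_map]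
  exact Polynomial.eval₂_at_apply (Φ : UnitaryGroup.LocalRing L v →+* UnitaryGroup.LocalRing L' v') (finGammaTwo L v γH)

/-- `(γ₂γ₁⁻¹ − 1)(1 − γ₂γ₃⁻¹)` transports: `finTauArg (e_H γ_H) = Φ (finTauArg γ_H)` (`χ_g(γ₂)` and `det g⁻¹` are carried by `Φ`). [cite: Rogawski1990, §4.9 p. 55] -/
theorem finTauArg_transport
    (L' : Type) [Field L'] [NumberField L'] [IsCMField L'] (v' : HeightOneSpectrum (𝓞 ↥(maximalRealSubfield L')))
    (Φ : UnitaryGroup.LocalRing L v ≃+* UnitaryGroup.LocalRing L' v')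
    (e₂ : (UnitaryGroup.cmDatum L 2 (Matrix.of fun i j : Fin 2 => if i.val + j.val + 1 = 2 then (1 : L) else 0)).Local v ≃ₜ*
      (UnitaryGroup.cmDatum L' 2 (Matrix.of fun i j : Fin 2 => if i.val + j.val + 1 = 2 then (1 : L') else 0)).Local v')
    (he₂ : ∀ g, ((e₂ g).val : GL (Fin 2) (UnitaryGroup.LocalRing L' v')) = Matrix.GeneralLinearGroup.map (Φ : UnitaryGroup.LocalRing L v →+* UnitaryGroup.LocalRing L' v') (g.val : GL (Fin 2) (UnitaryGroup.LocalRing L v)))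
    (e₁ : (UnitaryGroup.cmDatum L 1 (Matrix.of fun i j : Fin 1 => if i.val + j.val + 1 = 1 then (1 : L) else 0)).Local v ≃ₜ*
      (UnitaryGroup.cmDatum L' 1 (Matrix.of fun i j : Fin 1 => if i.val + j.val + 1 = 1 then (1 : L') else 0)).Local v')
    (he₁ : ∀ g, ((e₁ g).val : GL (Fin 1) (UnitaryGroup.LocalRing L' v')) = Matrix.GeneralLinearGroup.map (Φ : UnitaryGroup.LocalRing L v →+* UnitaryGroup.LocalRing L' v') (g.val : GL (Fin 1) (UnitaryGroup.LocalRing L v)))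
    (eH : ((UnitaryGroup.cmDatum L 2 (Matrix.of fun i j : Fin 2 => if i.val + j.val + 1 = 2 then (1 : L) else 0)).Local v ×
      (UnitaryGroup.cmDatum L 1 (Matrix.of fun i j : Fin 1 => if i.val + j.val + 1 = 1 then (1 : L) else 0)).Local v) ≃ₜ*
      ((UnitaryGroup.cmDatum L' 2 (Matrix.of fun i j : Fin 2 => if i.val + j.val + 1 = 2 then (1 : L') else 0)).Local v' ×
      (UnitaryGroup.cmDatum L' 1 (Matrix.of fun i j : Fin 1 => if i.val + j.val + 1 = 1 then (1 : L') else 0)).Local v'))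
    (heH : ∀ h, eH h = (e₂ h.1, e₁ h.2))
    (γH : ((UnitaryGroup.cmDatum L 2 (Matrix.of fun i j : Fin 2 => if i.val + j.val + 1 = 2 then (1 : L) else 0)).Local v ×
      (UnitaryGroup.cmDatum L 1 (Matrix.of fun i j : Fin 1 => if i.val + j.val + 1 = 1 then (1 : L) else 0)).Local v)) :
    finTauArg L' v' (eH γH) = Φ (finTauArg L v γH) := by
  have hinv : (((eH γH).1.val⁻¹).val : Matrix (Fin 2) (Fin 2) (UnitaryGroup.LocalRing L' v')) =
      ((γH.1.val⁻¹).val : Matrix (Fin 2) (Fin 2) (UnitaryGroup.LocalRing L v)).map Φ := by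
    rw [heH]
    dsimp only
    rw [he₂, ← map_inv]
    rfl
  unfold finTauArg
  rw [eval_finCharpolyTwo_transport L v L' v' Φ e₂ he₂ e₁ he₁ eH heH γH, hinv, map_mul, map_neg]
  congr 1
  exact ((Φ : UnitaryGroup.LocalRing L v →+* UnitaryGroup.LocalRing L' v').map_det _).symm

omit [IsCMField L] in
/-- **`μ′_{v′}(Φ x) = μ_v(x)`** (`finHeckeValue` reads the semi-local component at units; `hΦμ`, and units correspond under `Φ`). [cite: Rogawski1990, §4.9 p. 55] -/
theorem finHeckeValue_transport
    (L' : Type) [Field L'] [NumberField L'] (v' : HeightOneSpectrum (𝓞 ↥(maximalRealSubfield L')))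
    (Φ : UnitaryGroup.LocalRing L v ≃+* UnitaryGroup.LocalRing L' v')
    (μ : HeckeCharacter L) (μ' : HeckeCharacter L')
    (hΦμ : ∀ u : (UnitaryGroup.LocalRing L v)ˣ,
      μ'.semilocalComponent L' v' (Units.map (Φ : UnitaryGroup.LocalRing L v →+* UnitaryGroup.LocalRing L' v').toMonoidHom u) = μ.semilocalComponent L v u)
    (x : UnitaryGroup.LocalRing L v) :
    finHeckeValue L' v' μ' (Φ x) = finHeckeValue L v μ x := by
  by_cases hx : IsUnit x
  · have hx' : IsUnit (Φ x) := hx.map Φ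
    have hu : hx'.unit = Units.map (Φ : UnitaryGroup.LocalRing L v →+* UnitaryGroup.LocalRing L' v').toMonoidHom hx.unit :=
      Units.ext (by simp)
    rw [finHeckeValue_of_isUnit L v μ hx, finHeckeValue_of_isUnit L' v' μ' hx', hu, hΦμ]
  · have hx' : ¬ IsUnit (Φ x) := fun h => hx (by simpa using h.map Φ.symm)
    rw [finHeckeValue_of_not_isUnit L v μ hx, finHeckeValue_of_not_isUnit L' v' μ' hx']

/-- **(τ) `τ_{v′}(e_H γ_H) = τ_v(γ_H)`.** [cite: Rogawski1990, §4.9 p. 55] -/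
theorem finTau_transport
    (L' : Type) [Field L'] [NumberField L'] [IsCMField L'] (v' : HeightOneSpectrum (𝓞 ↥(maximalRealSubfield L')))
    (Φ : UnitaryGroup.LocalRing L v ≃+* UnitaryGroup.LocalRing L' v')
    (μ : HeckeCharacter L) (μ' : HeckeCharacter L')
    (hΦμ : ∀ u : (UnitaryGroup.LocalRing L v)ˣ,
      μ'.semilocalComponent L' v' (Units.map (Φ : UnitaryGroup.LocalRing L v →+* UnitaryGroup.LocalRing L' v').toMonoidHom u) = μ.semilocalComponent L v u)
    (e₂ : (UnitaryGroup.cmDatum L 2 (Matrix.of fun i j : Fin 2 => if i.val + j.val + 1 = 2 then (1 : L) else 0)).Local v ≃ₜ*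
      (UnitaryGroup.cmDatum L' 2 (Matrix.of fun i j : Fin 2 => if i.val + j.val + 1 = 2 then (1 : L') else 0)).Local v')
    (he₂ : ∀ g, ((e₂ g).val : GL (Fin 2) (UnitaryGroup.LocalRing L' v')) = Matrix.GeneralLinearGroup.map (Φ : UnitaryGroup.LocalRing L v →+* UnitaryGroup.LocalRing L' v') (g.val : GL (Fin 2) (UnitaryGroup.LocalRing L v)))
    (e₁ : (UnitaryGroup.cmDatum L 1 (Matrix.of fun i j : Fin 1 => if i.val + j.val + 1 = 1 then (1 : L) else 0)).Local v ≃ₜ*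
      (UnitaryGroup.cmDatum L' 1 (Matrix.of fun i j : Fin 1 => if i.val + j.val + 1 = 1 then (1 : L') else 0)).Local v')
    (he₁ : ∀ g, ((e₁ g).val : GL (Fin 1) (UnitaryGroup.LocalRing L' v')) = Matrix.GeneralLinearGroup.map (Φ : UnitaryGroup.LocalRing L v →+* UnitaryGroup.LocalRing L' v') (g.val : GL (Fin 1) (UnitaryGroup.LocalRing L v)))
    (eH : ((UnitaryGroup.cmDatum L 2 (Matrix.of fun i j : Fin 2 => if i.val + j.val + 1 = 2 then (1 : L) else 0)).Local v ×
      (UnitaryGroup.cmDatum L 1 (Matrix.of fun i j : Fin 1 => if i.val + j.val + 1 = 1 then (1 : L) else 0)).Local v) ≃ₜ*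
      ((UnitaryGroup.cmDatum L' 2 (Matrix.of fun i j : Fin 2 => if i.val + j.val + 1 = 2 then (1 : L') else 0)).Local v' ×
      (UnitaryGroup.cmDatum L' 1 (Matrix.of fun i j : Fin 1 => if i.val + j.val + 1 = 1 then (1 : L') else 0)).Local v'))
    (heH : ∀ h, eH h = (e₂ h.1, e₁ h.2))
    (γH : ((UnitaryGroup.cmDatum L 2 (Matrix.of fun i j : Fin 2 => if i.val + j.val + 1 = 2 then (1 : L) else 0)).Local v ×
      (UnitaryGroup.cmDatum L 1 (Matrix.of fun i j : Fin 1 => if i.val + j.val + 1 = 1 then (1 : L) else 0)).Local v)) :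
    finTau L' v' (eH γH) μ' = finTau L v γH μ := by
  unfold finTau
  rw [finGammaTwo_transport L v L' v' Φ e₂ e₁ he₁ eH heH γH, finTauArg_transport L v L' v' Φ e₂ he₂ e₁ he₁ eH heH γH,
    finHeckeValue_transport L v L' v' Φ μ μ' hΦμ, finHeckeValue_transport L v L' v' Φ μ μ' hΦμ]

/-! ## §3 (D): `D_{G∕H,v′}(e_H γ_H) = D_{G∕H,v}(γ_H)` — by G1-a -/

/-- **(D) `D_{G∕H,v′}(e_H γ_H) = D_{G∕H,v}(γ_H)`**: `χ_g(γ₂) ↦ Φ(χ_g(γ₂))` and `Φ` is a place-wise isometry (★ G1-a `prod_norm_map_ringEquiv_of_continuous`).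
[cite: Rogawski1990, §4.9 p. 55] -/
theorem finWeylRatio_transport
    (L' : Type) [Field L'] [NumberField L'] [IsCMField L'] (v' : HeightOneSpectrum (𝓞 ↥(maximalRealSubfield L')))
    (Φ : UnitaryGroup.LocalRing L v ≃+* UnitaryGroup.LocalRing L' v') (hc : Continuous Φ) (hc' : Continuous Φ.symm)
    (e₂ : (UnitaryGroup.cmDatum L 2 (Matrix.of fun i j : Fin 2 => if i.val + j.val + 1 = 2 then (1 : L) else 0)).Local v ≃ₜ*
      (UnitaryGroup.cmDatum L' 2 (Matrix.of fun i j : Fin 2 => if i.val + j.val + 1 = 2 then (1 : L') else 0)).Local v')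
    (he₂ : ∀ g, ((e₂ g).val : GL (Fin 2) (UnitaryGroup.LocalRing L' v')) = Matrix.GeneralLinearGroup.map (Φ : UnitaryGroup.LocalRing L v →+* UnitaryGroup.LocalRing L' v') (g.val : GL (Fin 2) (UnitaryGroup.LocalRing L v)))
    (e₁ : (UnitaryGroup.cmDatum L 1 (Matrix.of fun i j : Fin 1 => if i.val + j.val + 1 = 1 then (1 : L) else 0)).Local v ≃ₜ*
      (UnitaryGroup.cmDatum L' 1 (Matrix.of fun i j : Fin 1 => if i.val + j.val + 1 = 1 then (1 : L') else 0)).Local v')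
    (he₁ : ∀ g, ((e₁ g).val : GL (Fin 1) (UnitaryGroup.LocalRing L' v')) = Matrix.GeneralLinearGroup.map (Φ : UnitaryGroup.LocalRing L v →+* UnitaryGroup.LocalRing L' v') (g.val : GL (Fin 1) (UnitaryGroup.LocalRing L v)))
    (eH : ((UnitaryGroup.cmDatum L 2 (Matrix.of fun i j : Fin 2 => if i.val + j.val + 1 = 2 then (1 : L) else 0)).Local v ×
      (UnitaryGroup.cmDatum L 1 (Matrix.of fun i j : Fin 1 => if i.val + j.val + 1 = 1 then (1 : L) else 0)).Local v) ≃ₜ*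
      ((UnitaryGroup.cmDatum L' 2 (Matrix.of fun i j : Fin 2 => if i.val + j.val + 1 = 2 then (1 : L') else 0)).Local v' ×
      (UnitaryGroup.cmDatum L' 1 (Matrix.of fun i j : Fin 1 => if i.val + j.val + 1 = 1 then (1 : L') else 0)).Local v'))
    (heH : ∀ h, eH h = (e₂ h.1, e₁ h.2))
    (γH : ((UnitaryGroup.cmDatum L 2 (Matrix.of fun i j : Fin 2 => if i.val + j.val + 1 = 2 then (1 : L) else 0)).Local v ×
      (UnitaryGroup.cmDatum L 1 (Matrix.of fun i j : Fin 1 => if i.val + j.val + 1 = 1 then (1 : L) else 0)).Local v)) :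
    finWeylRatio L' v' (eH γH) = finWeylRatio L v γH := by
  unfold finWeylRatio
  rw [eval_finCharpolyTwo_transport L v L' v' Φ e₂ he₂ e₁ he₁ eH heH γH, prod_norm_map_ringEquiv_of_continuous L v L' v' Φ hc hc']

end Summit.HodgeConjecture.HodgeConjecture.R90.S3

end
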